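import Summits.SmoothPoincare4.SmoothPoincare4.Theorems.SullivanDualWitnessChargeDefs
import Mathlib.Analysis.Normed.Group.Bounded
import Mathlib.Topology.MetricSpace.Bounded

/-!
# A pencil member eventually enters every punctured chart-ball

Crux `WitnessCharge` (item stmt-SmoothPoincare4-7824, route route-SmoothPoincare4-SullivanDual),
line `Sketch`, stub `helper_memberEventuallyInBall`.

A pencil member `u : ℂ → Σ∖p` (`IsPencilMember J u b`) is PROPER: preimages of compact subsets of
`Σ∖p` are compact. For `η > 0` the complement `K_η` in `Σ∖p` of the punctured chart-ball of radius
`η` at `p` is compact (`Σ` is compact;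
`gromov_recognitionR4_relEnd.isCompact_compl_setOf_inPuncturedChartBall`), so `u ⁻¹' K_η` is a
compact, hence bounded, subset of `ℂ`: for `‖ξ‖` beyond a bound of it, `u ξ ∉ K_η`, i.e. `u ξ`
lies in the punctured `η`-chart-ball.
-/

noncomputable section

set_option linter.dupNamespace false

open scoped Manifold ContDiff Topology
open Set Filter Literature.Geometry.Kaehler Literature.Geometry.Symplectic
  Literature.Topology.FourManifolds

namespace Summit.SmoothPoincare4.SmoothPoincare4.Theorems.WitnessCharge.PencilIncompleteness

/-- **A pencil member eventually enters every punctured chart-ball.** If `u : ℂ → Σ∖p` is a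
pencil member (`IsPencilMember J u b`; in particular proper) and `η > 0`, then there is `r` such
that `u ξ` lies in the punctured `η`-chart-ball at `p` whenever `‖ξ‖ > r`. Proof: the complement
`K_η ⊆ Σ∖p` of the punctured chart-ball is compact (`Σ` compact), so `u ⁻¹' K_η ⊆ ℂ` is compact,
hence bounded in norm by some `r`. -/
theorem helper_memberEventuallyInBall :
    ∀ (S : HomotopySphere 4) (p : S.carrier)
      (J : ∀ x : punctured p, TangentSpace (𝓡 4) x →L[ℝ] TangentSpace (𝓡 4) x)
      (u : ℂ → punctured p) (b : ℂ), IsPencilMember J u b →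
      ∀ η : ℝ, 0 < η → ∃ r : ℝ, ∀ ξ : ℂ, r < ‖ξ‖ → InPuncturedChartBall p η (u ξ) := by
  intro S p J u b hu η hη
  obtain ⟨-, -, -, hproper, -, -⟩ := hu
  have hK : IsCompact (u ⁻¹' {x : punctured p | InPuncturedChartBall p η x}ᶜ) :=
    hproper _ (gromov_recognitionR4_relEnd.isCompact_compl_setOf_inPuncturedChartBall p hη)
  obtain ⟨r, hr⟩ := isBounded_iff_forall_norm_le.1 hK.isBounded
  refine ⟨r, fun ξ hξ => ?_⟩
  by_contra hnot
  exact absurd (hr ξ hnot) (not_le.2 hξ)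

end Summit.SmoothPoincare4.SmoothPoincare4.Theorems.WitnessCharge.PencilIncompleteness
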